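import Summits.ResolutionOfSingularities.ResolutionOfSingularities.Theorems.HoleCutLawJPlus
import HarnessLib

/-!
# HoleCutPoverty — decomp-res node «HoleCut» (lens-3 g18, critic row 143), tree file 2/4 of the node

Content VERBATIM from the decomp-res lens-3 g18 file `HOME/decomp-res-lens-3/g18/HoleCut.lean` (sha256 55250664…,
3677 l; = `parts/HoleCut-NODE-55250664.lean`;
HOME = run/shared/lean/pub/decomp-res), NEW sections only: its carried l. 89–3133 are lens-3 g17 TightCut
@7fe2fb69 VERBATIM and ALREADY in the tree as
`Theorems/TightCut*` / `MaxContactCutTightCut` (and the g13–g16 chain below them) — not landed again; the §M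
root `closes` (≡ `MaxContactCutExponentLadder.closes`)
is not restated.  Critic: CRITIC-LEDGER row 143 (CLEARED 2026-08-30T20:55:21Z); landing plan NODE-g18 §6.  Landed
by decomp-res writer g7 in the lens's namespace
`…Theorems.HoleCut` with `open …Theorems.TightCut` (the carried decls resolve against the landed TightCut
files).  Aside budget: the g17 residual 28532
`TightNoJointTailsFromFourDeep` is KEPT as the one booked item and re-informalled with its EXACT two-piece form
`four_iff_hole` (pieces A `NoSubcriticalJointTailsDeep`,
B `NoHoleFillingTailsDeep`, both in the cone-free `HoleCutClasses`), per the critic's budget option.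

§P₊ (l. 3331–3512) THE PARAMETRIC POVERTY LEDGER at shade `n` and modulus `q ≥ 3n − 2`: `TailShade`,
`HoleFill`, P3₊, P4₊, `exists_holeFill`, `holeFill_window`,
`holeFill_corner_four` (PROVED, 0 sorry).  Imports `HoleCutLawJPlus`.

[WRITER NOTE (decomp-res writer g7): section split only; every declaration as in the lens except: the lens's private
`eq_of_le_of_degree_le` (a `Fin 3` copy of the
tree's `ExitLaw.eq_of_le_of_degree_le`, opened here) is not restated; `chartExponent_of_ne` ↦ the landed
`ProximityCut.chartExponent_apply_ne` and `exists_third a b h` ↦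
`ConeCut.exists_third h` exactly as in the landed TightCut files; global `set_option` dropped.]

(Sources: CossartPiltant2008 Prop. 4.2; CossartPiltant2009; CossartJannsenSaito2020; Hauser2010; Moh1987;
BenitoVillamayor2012; HauserPerlega2024.)
-/

noncomputable section

open MvPolynomial Finset
open Literature.AlgebraicGeometry.Resolution
open Literature.AlgebraicGeometry.Resolution.Hauser2010
open Literature.AlgebraicGeometry.Resolution.PointBlowup
open Summit.ResolutionOfSingularities.ResolutionOfSingularities.Theses
open Summit.ResolutionOfSingularities.ResolutionOfSingularities.Theorems.TightDefectClasses
open Summit.ResolutionOfSingularities.ResolutionOfSingularities.Theorems.TightDefectStrongWalks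
open Summit.ResolutionOfSingularities.ResolutionOfSingularities.Theorems.ItineraryCutClasses
open Summit.ResolutionOfSingularities.ResolutionOfSingularities.Theorems.BoundaryLedger
open Summit.ResolutionOfSingularities.ResolutionOfSingularities.Theorems.ProximityCut
open Summit.ResolutionOfSingularities.ResolutionOfSingularities.Theorems.ConeCutAxisLaw
open Literature.AlgebraicGeometry.Resolution.WeightedBlowup
open Literature.Barriers.ResolutionOfSingularities
open Summit.ResolutionOfSingularities.ResolutionOfSingularities.Theorems.FloorCut
open Summit.ResolutionOfSingularities.ResolutionOfSingularities.Theorems.ConeCut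
open Summit.ResolutionOfSingularities.ResolutionOfSingularities.Theorems.ExitLaw (fin3_cases eq_of_le_of_degree_le)
open Summit.ResolutionOfSingularities.ResolutionOfSingularities.Theorems.ShadeCut
open Summit.ResolutionOfSingularities.ResolutionOfSingularities.Theorems.TightCut

namespace Summit.ResolutionOfSingularities.ResolutionOfSingularities.Theorems.HoleCut

/-! ## §P₊  THE PARAMETRIC POVERTY LEDGER (new, g18): at shade `n` and modulus `q ≥ 3n − 2`, a joint tail FILLS
HOLES infinitely often — ONE proof for all shades

Write `D_t = |r_t|`; on a shade-`n` tail with positive excess `o_t = D_t + n ∈ (q, 2q)`, the newest mass is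
`r_{t+1}(j_t) = D_t + n − q ≥ 1`.  Stage `t` is POOR if `r_t` has a zero coordinate (`HasZero`, g16); then `D_t ≤
q − 1` (P1, axis law).  (P2) a translated move makes the next stage poor.  (P3₊) poverty PROPAGATES through every
move except a HOLE-FILLING one: an untranslated chart change INTO the zero coordinate (`HoleFill`).  (P4₊) if stages
`u, u+1` are poor and move `u+1` is a proximity repeat, the kept mass of move `u+1` is at most the newest mass
`D_u + n − q ≤ n − 1`, so `D_{u+2} ≤ 2n − 2` — below the window `D_{u+2} ≥ q + 1 − n` as soon as `q
≥ 3n − 2` —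
UNLESS move `u+1` is untranslated into the hole: a hole-filling move.  Hence (REDUCTION) a joint tail of shade `n`
with `q ≥ 3n − 2` makes hole-filling moves infinitely often; and (DEFICIT WINDOW) at a hole-filling move the corner
`D_{u+1} = r_{u+1}(j_u) + r_{u+1}(k)` satisfies `q + 1 − n ≤ corner` (ledger two moves on) and `3·corner ≤ 3q
− 3 − n`
(LAW J⁺).  At `n = 3` this window is the TIGHT corner `q − 2` and LAW J₂ closes it (g17); at `n = 4` it is the
single value `corner = q − 3`; at `n = 5, 6` it is `{q − 4, q − 3}`, `{q − 5, …, q − 3}`. -/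

section PovertyShade

variable {K : Type} [Field K] [DecidableEq K] {q : ℕ} {s₀ : State (Fin 3) K}

/-- The hypotheses of a SHADE-`n` TAIL from stage `N`, bundled: plateau, shade `n`, positive excess.
DEFINITION (support). -/
structure TailShade (W : ForcedWalk q s₀) (N n : ℕ) : Prop where
  plat : ∀ t, N ≤ t → (W.st (t + 1)).shade = (W.st t).shade
  shade : (W.st N).shade = (n : ℕ∞)
  ex : ∀ t, N ≤ t → ordZero (W.st t).F ≠ ((q : ℕ) : ℕ∞)

/-- Move `u+1` is HOLE-FILLING: an untranslated chart change INTO a coordinate at which the boundary vanishes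
(`b_{u+1} = 0`, `j_{u+1} ≠ j_u`, `r_{u+1}(j_{u+1}) = 0`).  DEFINITION (support; tree letters only). -/
def HoleFill (W : ForcedWalk q s₀) (u : ℕ) : Prop :=
  W.b (u + 1) = 0 ∧ W.j (u + 1) ≠ W.j u ∧ (W.st (u + 1)).r (W.j (u + 1)) = 0

/-- A hole-filling move is a proximity repeat (`StaysOnNewest`). [folklore] -/
theorem HoleFill.stays {W : ForcedWalk q s₀} {u : ℕ} (h : HoleFill W u) : StaysOnNewest W u :=
  ⟨h.2.1, by rw [h.1]; rfl⟩

namespace TailShade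

variable {W : ForcedWalk q s₀} {N n : ℕ}

/-- `shade_eq`: Auxiliary step of this node's calculus, VERBATIM from the lens file (see the module docstring); the
statement is its type. [folklore] -/
theorem shade_eq (h : TailShade W N n) : ∀ t, N ≤ t → (W.st t).shade = (n : ℕ∞) :=
  shade_of_plateau W h.plat h.shade

/-- The order window `q < o_t = D_t + n < 2q` on the tail. [folklore] -/
theorem order (hroot : IsRoot q s₀) (h : TailShade W N n) (t : ℕ) (ht : N ≤ t) :
    ∃ o : ℕ, ordZero (W.st t).F = o ∧ q < o ∧ o < 2 * q ∧ o = n + (W.st t).r.degree := by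
  obtain ⟨o, ho, hqo, ho2⟩ := NoJump.order_lt_two_mul hroot W t
  have hne : o ≠ q := by
    intro hoq
    exact h.ex t ht (by rw [ho, hoq])
  exact ⟨o, ho, by omega, ho2, order_eq_of_plateau hroot W ho (h.shade_eq t ht)⟩

/-- THE LEDGER of a tail move: `D_{t+1} + q = |kept_t| + D_t + n`, newest mass `D_t + n − q`, off-chart
coordinates kept. [folklore] -/
theorem step (hroot : IsRoot q s₀) (h : TailShade W N n) (t : ℕ) (ht : N ≤ t) :
    (W.st (t + 1)).r.degree + q = (kept W t).degree + (W.st t).r.degree + n ∧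
    (W.st (t + 1)).r (W.j t) + q = (W.st t).r.degree + n ∧
    ∀ i, i ≠ W.j t → (W.st (t + 1)).r i = kept W t i := by
  obtain ⟨o, ho, hqo, -, hod⟩ := h.order hroot t ht
  have hdeg := degree_r_succ W t ho
  have hch := NoJump.r_succ_chart W t ho
  refine ⟨by omega, by omega, fun i hi => ?_⟩
  rw [r_succ_eq W t ho, Finsupp.add_apply, Finsupp.single_eq_of_ne hi, add_zero]

/-- `degree_window`: Auxiliary step of this node's calculus, VERBATIM from the lens file (see the module docstring);
the statement is its type. [folklore] -/
theorem degree_window (hroot : IsRoot q s₀) (h : TailShade W N n) (t : ℕ) (ht : N ≤ t) :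
    q + 1 ≤ (W.st t).r.degree + n ∧ (W.st t).r.degree + n + 1 ≤ 2 * q := by
  obtain ⟨o, -, hqo, ho2, hod⟩ := h.order hroot t ht
  omega

/-- **(P3₊) POVERTY PROPAGATES EXCEPT THROUGH A HOLE-FILLING MOVE.** [new] [folklore] -/
theorem hasZero_succ_or_holeFill (hroot : IsRoot q s₀) (h : TailShade W N n) (u : ℕ) (hu : N ≤ u)
    (hz : HasZero W (u + 1)) : HasZero W (u + 2) ∨ HoleFill W u := by
  obtain ⟨l, hl⟩ := hz
  obtain ⟨o₁, ho₁, hq1, -, -⟩ := h.order hroot (u + 1) (by omega)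
  by_cases hb : W.b (u + 1) = 0
  · by_cases hc : W.j (u + 1) = l
    · right
      obtain ⟨o₀, -, hq0, -, hod0⟩ := h.order hroot u hu
      obtain ⟨-, hn, -⟩ := h.step hroot u hu
      refine ⟨hb, fun heq => ?_, by rw [hc]; exact hl⟩
      rw [← heq, hc] at hn
      omega
    · left
      obtain ⟨-, -, hkeep⟩ := h.step hroot (u + 1) (by omega)
      refine ⟨l, ?_⟩
      rw [hkeep l (fun h' => hc h'.symm), kept_apply]
      split_ifs
      · exact hl
      · rfl
  · exact Or.inl (hasZero_of_translated W (u + 1) ho₁ hb)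

/-- **(P4₊) BETWEEN TWO POOR STAGES A PROXIMITY REPEAT IS HOLE-FILLING** (`q ≥ 3n − 2`): otherwise the kept mass of
move `u+1` is at most the newest mass `≤ n − 1` and `D_{u+2} ≤ 2n − 2 < q + 1 − n`. [new] [folklore] -/
theorem holeFill_of_repeat (hroot : IsRoot q s₀) (hq : 3 * n ≤ q + 2) (h : TailShade W N n) (u : ℕ) (hu : N ≤ u)
    (hz0 : HasZero W u) (hz1 : HasZero W (u + 1)) (hS : StaysOnNewest W u) : HoleFill W u := by
  obtain ⟨hne, hbn⟩ := hS
  obtain ⟨m, hmn, hmc⟩ := exists_third hne.symm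
  have hD0 := degree_lt_of_hasZero hroot W u hz0
  have hD1 := degree_lt_of_hasZero hroot W (u + 1) hz1
  obtain ⟨-, hn, -⟩ := h.step hroot u hu
  obtain ⟨hd1, -, -⟩ := h.step hroot (u + 1) (by omega)
  rw [show u + 1 + 1 = u + 2 from rfl] at hd1
  have hw0 := h.degree_window hroot u hu
  have hw2 := h.degree_window hroot (u + 2) (by omega)
  obtain ⟨hk, hkm⟩ := TailThree.kept_three W u hne hmn hmc hbn
  have hdeg1 : (W.st (u + 1)).r.degree = (W.st (u + 1)).r (W.j u) + (W.st (u + 1)).r (W.j (u + 1)) +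
      (W.st (u + 1)).r m := degree_eq_three (W.st (u + 1)).r hne.symm hmn hmc
  by_cases hbm : W.b (u + 1) m = 0
  · rw [if_pos hbm] at hkm
    have hb0 : W.b (u + 1) = 0 := by
      funext x
      rcases fin3_cases hne.symm hmn hmc x with hx | hx | hx <;> rw [hx]
      · exact hbn
      · exact W.onExc (u + 1)
      · exact hbm
    obtain ⟨l, hl⟩ := hz1
    rcases fin3_cases hne.symm hmn hmc l with hx | hx | hx <;> rw [hx] at hl
    · omega
    · exact ⟨hb0, hne, hl⟩
    · omega
  · rw [if_neg hbm] at hkm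
    omega

/-- **REDUCTION (PROVED): ON A SUPERCRITICAL JOINT TAIL HOLE-FILLING MOVES RECUR.**  Shade `n`, `q ≥ 3n − 2`,
positive excess, proximity repeats i.o. and translated moves i.o. ⇒ hole-filling moves i.o.: after a translation
every stage is poor until a hole is filled (P2, P3₊), and a repeat between poor stages fills a hole (P4₊). [new]
[folklore] -/
theorem exists_holeFill (hroot : IsRoot q s₀) (hq : 3 * n ≤ q + 2) (h : TailShade W N n)
    (hrep : ∀ M, ∃ t, M ≤ t ∧ StaysOnNewest W t) (htr : ∀ M, ∃ t, M ≤ t ∧ W.b t ≠ 0) (M : ℕ) :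
    ∃ u, M ≤ u ∧ N ≤ u ∧ HoleFill W u := by
  by_contra hno
  push Not at hno
  obtain ⟨t₁, ht₁, hb⟩ := htr (M + N)
  obtain ⟨o, ho, -⟩ := h.order hroot t₁ (by omega)
  have hz : HasZero W (t₁ + 1) := hasZero_of_translated W t₁ ho hb
  have hall : ∀ d, HasZero W (t₁ + d + 1) := by
    intro d
    induction d with
    | zero => exact hz
    | succ d ih =>
      rw [show t₁ + (d + 1) + 1 = t₁ + d + 2 by omega]
      rcases h.hasZero_succ_or_holeFill hroot (t₁ + d) (by omega) ih with h' | h'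
      · exact h'
      · exact absurd h' (hno (t₁ + d) (by omega) (by omega))
  obtain ⟨u, hu, hS⟩ := hrep (t₁ + 1)
  have hz0 : HasZero W u := by
    have := hall (u - t₁ - 1)
    rwa [show t₁ + (u - t₁ - 1) + 1 = u by omega] at this
  have hz1 : HasZero W (u + 1) := by
    have := hall (u - t₁)
    rwa [show t₁ + (u - t₁) + 1 = u + 1 by omega] at this
  exact hno u (by omega) (by omega) (h.holeFill_of_repeat hroot hq u (by omega) hz0 hz1 hS)

/-- **THE DEFICIT WINDOW OF A HOLE-FILLING MOVE (PROVED)**: the corner `D_{u+1} = r_{u+1}(j_u) + r_{u+1}(k)`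
satisfies `q + 1 ≤ corner + n` (the ledger two moves on: the hole-filling move keeps ALL of `D_{u+1}`) and
`3·corner + n + 3 ≤ 3q` (LAW J⁺). [new] [folklore] -/
theorem holeFill_window (hroot : IsRoot q s₀) (h : TailShade W N n) (u : ℕ) (hu : N ≤ u) (hf : HoleFill W u) :
    q + 1 ≤ (W.st (u + 1)).r.degree + n ∧ 3 * (W.st (u + 1)).r.degree + n + 3 ≤ 3 * q := by
  obtain ⟨hb, hne, hzero⟩ := hf
  obtain ⟨k, hkj, hki⟩ := exists_third hne.symm
  obtain ⟨o₀, ho₀, hq0, -, -⟩ := h.order hroot u hu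
  obtain ⟨o₁, ho₁, hq1, -, -⟩ := h.order hroot (u + 1) (by omega)
  have hJ := corner_bound_shade hroot W u ho₀ ho₁ hq0 hq1 (h.plat u hu) (h.plat (u + 1) (by omega))
    (h.shade_eq u hu) hne hb hki hkj
  have hdeg1 : (W.st (u + 1)).r.degree = (W.st (u + 1)).r (W.j u) + (W.st (u + 1)).r (W.j (u + 1)) +
      (W.st (u + 1)).r k := degree_eq_three (W.st (u + 1)).r hne.symm hkj hki
  obtain ⟨hd1, -, -⟩ := h.step hroot (u + 1) (by omega)
  rw [show u + 1 + 1 = u + 2 from rfl] at hd1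
  have hkept1 := kept_degree_of_untranslated W (u + 1) hb
  have hw2 := h.degree_window hroot (u + 2) (by omega)
  constructor
  · omega
  · omega

/-- **AT SHADE FOUR THE HOLE-FILLING CORNER IS EXACTLY `q − 3` (PROVED)** — the analogue of g17's TIGHT corner
`q − 2` at shade three. [new] [folklore] -/
theorem holeFill_corner_four (hroot : IsRoot q s₀) (h : TailShade W N 4) (u : ℕ) (hu : N ≤ u) (hf : HoleFill W u) :
    (W.st (u + 1)).r.degree + 3 = q := by
  obtain ⟨h1, h2⟩ := h.holeFill_window hroot u hu hf
  omega

end TailShade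

end PovertyShade

end Summit.ResolutionOfSingularities.ResolutionOfSingularities.Theorems.HoleCut
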